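import Literature.MathematicalPhysics.QuantumFieldTheory.Balaban1983to89.B8Thm4CoreZd3LanE
import Literature.MathematicalPhysics.QuantumFieldTheory.Balaban1983to89.B8Thm8SurvivingZd3H

/-!
# `Balaban1983to89.B8Thm8SurvivingZd3MapHE` — [Balaban1985RegularSpaces] THEOREM 8 (p. 101), SURVIVING FORM, ON THE `Ω₀ = ℤᵈ` MEMBERS OF THE REPAIRED CARRIER
# `B8LeafModelZd3H.zdGF3H` OVER AN ARBITRARY INDEX MAP `ι : J → ZdIdx d L`, PROPOSITION 5's UNIQUENESS SOCKET IN THE REPAIRED (E) CURRENCY —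
# this seat's `B8Thm8SurvivingZd3Map.thm4Core_zd3_map_lan` ∕ `B8Thm8SurvivingZd3MapH.thm8SurvivingAt_zd3H_map_lan` re-run on n05-c g6's
# `B8Thm4CoreZd3LanE.thm4Core_zd3_lanE` (the ρ3 `SP5u` binder: `SockP5uE`'s text at `LanF a U₀ φ (ι a).k`)

statement-level skeleton of published theorems with citation tags; proofs where landed; nothing here is a claim about the
Yang–Mills mass gap

PDF held: `paper:balaban1985-cmp99-regular-spaces-gauge-fixing` (journal page = PDF page + 74); Thm 8 p. 101 ((1.146)), Thm 4 p. 88, Prop. 5 p. 94,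
(1.62) p. 87, (1.29) p. 81; [4] = [Balaban1985BackgroundPropagators] Thm 3.3 p. 398.

WHY THIS FILE (cell `pub-ymgap`, HUMAN RULING D-0062; R134 acceleration seat `pub-ymgap-dag-n05-d` (g5)).  The `SP5u` binder of the ρ2 assemblies
(`B8Thm8SurvivingZd3H.thm8SurvivingAt_zd3H_univ_lan`, this seat's ι-generic `B8Thm8SurvivingZd3MapH.thm8SurvivingAt_zd3H_map_lan`) is in the pre-E
tower-local currency, which no provider of record serves (INBOX FINDING SP5u-CURRENCY 2026-08-27; n04-b g5's location, n05-a g7's consumer repair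
`B8Thm4UniqueE` ∕ `B8Thm4ConcreteE`).  n05-c g6 re-knit the member-free driver and the core in the repaired currency (`B8Thm4ConcreteLanE`,
`B8Thm4CoreZd3LanE`, on this seat's `B8Thm4UniqueELan.thm4_unique_eq_lanE`); THIS FILE is the ι-generic twin on that core — **`thm4Core_zd3_map_lanE`**
(the Theorem-4-shaped core over an index map, sockets AT `ι a`, `SP5u` in the E currency; proof = `thm4Core_zd3_map_lan`'s source-index enlargement
`J × Φ` verbatim on `thm4Core_zd3_lanE`) and **`thm8SurvivingAt_zd3H_map_lanE`** (`B8.Thm8SurvivingAt γ (5dL·B₈·(1+11d²)) (5dL·B₀β·(1+11d²))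
(zdGF3H ∘ ι)` for any `ι` into the `Ω 0 = univ` members, modulo `SP5base` ∕ `SP5` ∕ `SH59src` ∕ `SP5u`(E) ∕ `SP3src` AT `ι a` with the ρ2 source
premiss; proof = `thm8SurvivingAt_zd3H_map_lan`'s verbatim, the binder is only passed).  The `SP5u` text at `LanF a := LanF146 …` is the conclusion of
this seat's provider `B8SockSP5uProviderSrc.sp5uE_of_lettersUB_src` token for token; the N05 faces on `Node00.CarriersB8SubBH` (n05-c g6 H1∕H2) key on
this file.

HONEST SCOPE.  Re-keying only: Proposition 5 (both halves, sourced), the sourced b9 socket and the sourced Proposition 3 remain HYPOTHESES (now at `ι a`);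
no estimate is proved here beyond the cited assembly; constants unchanged.  Count-neutral; N05 NOT discharged; one finite T⁴ programme at fixed ε;
nothing continuum / ℝ⁴ / OS / mass-gap / Clay.  No `sorry`, no `def`, no `instance`, no `notation`.  Unit `pub-ymgap-dag-n05-d` (g5), 2026-08-27.
-/

noncomputable section

open NormedSpace

namespace Literature.MathematicalPhysics.QuantumFieldTheory.Balaban1983to89.B8Thm8SurvivingZd3MapHE

open Complex (I)
open MatrixLog B7Prop1Explicit B7Prop2Explicit B7Prop1Local B7Eq92Concrete
open B7Prop2Explicit (C0 c2')
open B7Prop3Flat (c3)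
open B8Ineq132 (covDerivFwd InAk BondTouches)
open B8Eq119TwistedAxial (Restr129 InAx)
open B8Eq184Proof (gaugeExp cfgExp)
open B8Lemma1NonAbelian (mulCfg)
open B8Eq140Level (SideTouches)
open B8Eq146AExpansion (iEta)
open B7Prop4GeneralLevels (logCovIter linCovIter)
open B8Eq155JBound (Jcur wsup)
open B8ScaledSupNorm (bondNorm msup)
open B8Thm2LogB (blockTop)
open B8Ineq130 (tlo thi)
open B8Eq138LandauZd (IsLandau146W InR138 logCfg)
open B8Thm4Windows (thm4_windows thm4_windows_extra)
open B8LeafModelZd (ZdIdx)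
open B8LeafModelZd3 (zdGF3)
open B8LeafModelZd3H (zdGF3H)
open B8ScaledSupNorm (Bdd)
open B8Ineq166Univ (norm_pert_sub_one_le_univ)
open B8Thm4CoreZd3LanE (thm4Core_zd3_lanE)

-- `Site` alone could resolve to the torus sites of `Setup.lean`; re-export the `ℤ^d` sites of `B7Prop1Explicit`.
export B7Prop1Explicit (Site)

variable {d : ℕ}

/-! ## §1 The Theorem-4-shaped core over an index map, E currency (from `thm4Core_zd3_lanE` BY NAME, enlarged source index) -/

section Core

variable {𝔸 : Type} [CStarAlgebra 𝔸] [Nontrivial 𝔸]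

/-- **THEOREM 4 ∕ THEOREM 8, THE THEOREM-4-SHAPED CORE AT `zdGF3` OVER AN INDEX MAP `ι : J → ZdIdx d L`** — `B8Thm4CoreZd3LanE.thm4Core_zd3_lanE` with
admissibility `Adm`, gauge predicate `LanF` and the four sourced sockets `SP5base`∕`SP5`∕`SH59src`∕`SP5u` indexed by `J` and demanded AT `ι a` ONLY:
ONE threshold `c₁` (constants only) such that at every `a : J` the carrier's (1.33) ∕ (1.34) ∕ (1.35)+(1.66)₀ at `(α₀, α₁)` and an admitted source
`φ` give a restricted `u` with (1.37) `C137 α₁`, `LanF a U₀ φ (ι a).k` for `U′^{u⁻¹}`, the (1.62)-shape `C162 (5dL·B₈) (α₀ + α₁)`, unique among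
restricted competitors with the gauge condition and the (1.62)-shape.  PROOF: the landed ∀-theorem at the source index `J × Φ`,
`Adm′ i (a, φ) := ι a = i ∧ Adm a φ`, `LanF′ i U₀ (a, φ) := LanF a U₀ φ` — its ∀-sockets hold vacuously off the range of `ι` and are the
`J`-sockets on it. [cite: Balaban1985RegularSpaces, Thm 8 (1.146) p.101, Thm 4 p.88, (1.29) p.81, (1.37)–(1.38) p.82, (1.62) p.87, Prop. 5 p.94; Balaban1985BackgroundPropagators, Thm 3.3 p.398] -/
theorem thm4Core_zd3_map_lanE (hd2 : 2 ≤ d) {L : ℕ} (hL : 2 ≤ L) {β : ℝ} {len : Site d → ℝ} {B₀ B₀' cu cP : ℝ} (hB₀ : 0 < B₀)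
    (hB₀' : 0 < B₀') (hcu : 0 < cu) (hcP : 0 < cP)
    {Φ : Type*} {γ' B₈ : ℝ} (hγ' : 0 ≤ γ') (hB₈ : 0 < B₈) (hB₀8 : B₀ ≤ B₈) (hB : 2 ≤ 5 * (d : ℝ) * L * B₈)
    (hγB : 5 * (d : ℝ) * L * B₀ + 2 * (γ' * B₀) ≤ 5 * (d : ℝ) * L * B₈)
    {J : Type} (ι : J → ZdIdx d L)
    (Adm : J → Φ → (Site d → Fin d → 𝔸ˣ) → ℝ → ℝ → Prop)
    (LanF : J → (Site d → Fin d → 𝔸ˣ) → Φ → ℕ → (Site d → Fin d → 𝔸ˣ) → Prop)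
    (SP5base : ∀ a : J, ∀ α₀ α₁ : ℝ, 0 < α₀ → 0 < α₁ → α₀ + α₁ ≤ cP →
      ∀ U₀ U' : Site d → Fin d → 𝔸ˣ, (∀ x κ, U₀ x κ ∈ unitaryUnits 𝔸) → (∀ x κ, U' x κ ∈ unitaryUnits 𝔸) →
      ∀ φ : Φ, Adm a φ U₀ α₀ α₁ →
      InAk L (ι a).k (ι a).η α₀ (ι a).Ω U₀ → InAk L (ι a).k (ι a).η α₀ (ι a).Ω (mulCfg U' U₀) → (∀ m, m ≤ (ι a).k → InAx L m ((ι a).Λs m) U₀ (mulCfg U' U₀)) →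
      (∀ j, j ≤ (ι a).k → ∀ (z : Site d) (μ : Fin d), (∀ x, InBox (loK L j z) (bondHiK L j z μ) x → x ∈ (ι a).Ω j) →
        ‖(avgIter L (mulCfg U' U₀) j z μ : 𝔸) - (avgIter L U₀ j z μ : 𝔸)‖ ≤ α₁) →
      (∀ b ∈ {b : Site d × Fin d | SideTouches ((ι a).Ω 0) b.1 b.2}, ‖((U' b.1 b.2 : 𝔸ˣ) : 𝔸) - 1‖ ≤ α₁) →
      (∃ (v : Site d → 𝔸ˣ) (lam : Site d → 𝔸), (∀ x, v x ∈ unitaryUnits 𝔸) ∧ (∀ x, x ∉ (ι a).Ω 0 → v x = 1) ∧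
        (∀ j, j ≤ 1 → ∀ b ∈ {b : Site d × Fin d | SideTouches ((ι a).Ω j) b.1 b.2}, (v b.1 : 𝔸) = ((gaugeExp lam b.1 : 𝔸ˣ) : 𝔸) ∧
        (v (b.1 + e b.2) : 𝔸) = ((gaugeExp lam (b.1 + e b.2) : 𝔸ˣ) : 𝔸)) ∧
        (∀ j, j ≤ 1 → ∀ b ∈ {b : Site d × Fin d | SideTouches ((ι a).Ω j) b.1 b.2},
        ‖lam b.1‖ ≤ (8 * B₀' * (5 * (d : ℝ) * L * B₈) * (α₀ + α₁)) ∧ ((L : ℝ) ^ j * (ι a).η) * ‖covDerivFwd (ι a).η U₀ b.2 lam b.1‖ ≤ (8 * B₀' * (5 * (d : ℝ) * L * B₈) * (α₀ + α₁))) ∧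
        LanF a U₀ φ 1 (mgauge U₀ v⁻¹ U') ∧ Restr129 L 1 ((ι a).Λs 1) U₀ ((1 : Site d → 𝔸ˣ) * v)))
    (SP5 : ∀ a : J, ∀ α₀ α₁ : ℝ, 0 < α₀ → 0 < α₁ → α₀ + α₁ ≤ cP →
      ∀ U₀ U' : Site d → Fin d → 𝔸ˣ, (∀ x κ, U₀ x κ ∈ unitaryUnits 𝔸) → (∀ x κ, U' x κ ∈ unitaryUnits 𝔸) →
      ∀ φ : Φ, Adm a φ U₀ α₀ α₁ →
      InAk L (ι a).k (ι a).η α₀ (ι a).Ω U₀ → InAk L (ι a).k (ι a).η α₀ (ι a).Ω (mulCfg U' U₀) → (∀ m, m ≤ (ι a).k → InAx L m ((ι a).Λs m) U₀ (mulCfg U' U₀)) →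
      (∀ j, j ≤ (ι a).k → ∀ (z : Site d) (μ : Fin d), (∀ x, InBox (loK L j z) (bondHiK L j z μ) x → x ∈ (ι a).Ω j) →
        ‖(avgIter L (mulCfg U' U₀) j z μ : 𝔸) - (avgIter L U₀ j z μ : 𝔸)‖ ≤ α₁) →
      (∀ b ∈ {b : Site d × Fin d | SideTouches ((ι a).Ω 0) b.1 b.2}, ‖((U' b.1 b.2 : 𝔸ˣ) : 𝔸) - 1‖ ≤ α₁) →
      (∀ m, 1 ≤ m → m < (ι a).k → ∀ (u₁ : Site d → 𝔸ˣ) (U₁ : Site d → Fin d → 𝔸ˣ) (A : Site d → Fin d → 𝔸),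
        (∀ x, u₁ x ∈ unitaryUnits 𝔸) → (∀ x, x ∉ (ι a).Ω 0 → u₁ x = 1) → mgauge U₀ u₁ U₁ = U' → Restr129 L m ((ι a).Λs m) U₀ u₁ →
        LanF a U₀ φ m U₁ →
        (∀ j, j ≤ m → ∀ b ∈ {b : Site d × Fin d | SideTouches ((ι a).Ω j) b.1 b.2},
        U₁ b.1 b.2 = cfgExp (ι a).η A b.1 b.2 ∧ IsSelfAdjoint (A b.1 b.2) ∧ ‖A b.1 b.2‖ ≤ (5 * (d : ℝ) * L * B₈ * (α₀ + α₁)) * ((L : ℝ) ^ j * (ι a).η)⁻¹) →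
        ∃ (v : Site d → 𝔸ˣ) (lam : Site d → 𝔸), (∀ x, v x ∈ unitaryUnits 𝔸) ∧ (∀ x, x ∉ (ι a).Ω 0 → v x = 1) ∧
        (∀ j, j ≤ m + 1 → ∀ b ∈ {b : Site d × Fin d | SideTouches ((ι a).Ω j) b.1 b.2}, (v b.1 : 𝔸) = ((gaugeExp lam b.1 : 𝔸ˣ) : 𝔸) ∧
        (v (b.1 + e b.2) : 𝔸) = ((gaugeExp lam (b.1 + e b.2) : 𝔸ˣ) : 𝔸)) ∧
        (∀ j, j ≤ m + 1 → ∀ b ∈ {b : Site d × Fin d | SideTouches ((ι a).Ω j) b.1 b.2},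
        ‖lam b.1‖ ≤ (8 * B₀' * (5 * (d : ℝ) * L * B₈) * (α₀ + α₁)) ∧ ((L : ℝ) ^ j * (ι a).η) * ‖covDerivFwd (ι a).η U₀ b.2 lam b.1‖ ≤ (8 * B₀' * (5 * (d : ℝ) * L * B₈) * (α₀ + α₁))) ∧
        LanF a U₀ φ (m + 1) (mgauge U₀ v⁻¹ U₁) ∧ Restr129 L (m + 1) ((ι a).Λs (m + 1)) U₀ (u₁ * v)))
    (SH59src : ∀ a : J, ∀ α₀ α₁ : ℝ, 0 < α₀ → 0 < α₁ → α₀ + α₁ ≤ cP →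
      ∀ U₀ U' : Site d → Fin d → 𝔸ˣ, (∀ x κ, U₀ x κ ∈ unitaryUnits 𝔸) → (∀ x κ, U' x κ ∈ unitaryUnits 𝔸) →
      ∀ φ : Φ, Adm a φ U₀ α₀ α₁ →
      InAk L (ι a).k (ι a).η α₀ (ι a).Ω U₀ → InAk L (ι a).k (ι a).η α₀ (ι a).Ω (mulCfg U' U₀) → (∀ m, m ≤ (ι a).k → InAx L m ((ι a).Λs m) U₀ (mulCfg U' U₀)) →
      (∀ j, j ≤ (ι a).k → ∀ (z : Site d) (μ : Fin d), (∀ x, InBox (loK L j z) (bondHiK L j z μ) x → x ∈ (ι a).Ω j) →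
        ‖(avgIter L (mulCfg U' U₀) j z μ : 𝔸) - (avgIter L U₀ j z μ : 𝔸)‖ ≤ α₁) →
      (∀ b ∈ {b : Site d × Fin d | SideTouches ((ι a).Ω 0) b.1 b.2}, ‖((U' b.1 b.2 : 𝔸ˣ) : 𝔸) - 1‖ ≤ α₁) →
      (∀ m, 1 ≤ m → m ≤ (ι a).k → ∀ (u : Site d → 𝔸ˣ) (W : Site d → Fin d → 𝔸ˣ) (A' : Site d → Fin d → 𝔸),
        (∀ x, u x ∈ unitaryUnits 𝔸) → mgauge U₀ u W = U' → Restr129 L m ((ι a).Λs m) U₀ u → LanF a U₀ φ m W →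
        (∀ y τ, IsSelfAdjoint (A' y τ)) →
        (∀ j, j ≤ m → ∀ y τ, SideTouches ((ι a).Ω j) y τ →
        W y τ = cfgExp (ι a).η A' y τ ∧ ‖A' y τ‖ ≤ (2 * (L * (5 * (d : ℝ) * L * B₈ * (α₀ + α₁))) + 8 * (8 * B₀' * (5 * (d : ℝ) * L * B₈) * (α₀ + α₁))) * ((L : ℝ) ^ j * (ι a).η)⁻¹) →
        (∀ y τ, (∀ j, j ≤ m → ¬ SideTouches ((ι a).Ω j) y τ) → A' y τ = 0) →
        msup L m (ι a).η (-(1 : ℝ)) (fun j (b : Site d × Fin d) => SideTouches ((ι a).Ω j) b.1 b.2) (fun b => A' b.1 b.2)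
        ≤ B₀ * (bondNorm L m (ι a).η (-(3 : ℝ)) (ι a).Ω (fun x μ => Jcur (ι a).η U₀ A' μ x)
        + wsup 1 (fun p : {p : ℕ × (Site d × Fin d) // p.1 ≤ m ∧ p.2 ∈ (ι a).Λb m p.1} =>
        linCovIter L U₀ (iEta (ι a).η A') p.1.1 p.1.2.1 p.1.2.2)) + γ' * B₀ * (α₀ + α₁) ∧
        msup L m (ι a).η (-(2 : ℝ)) (fun j (t : Fin d × Fin d × Site d) => SideTouches ((ι a).Ω j) t.2.2 t.2.1)
        (fun t => covDerivFwd (ι a).η U₀ t.1 (fun z => A' z t.2.1) t.2.2)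
        ≤ B₀ * (bondNorm L m (ι a).η (-(3 : ℝ)) (ι a).Ω (fun x μ => Jcur (ι a).η U₀ A' μ x)
        + wsup 1 (fun p : {p : ℕ × (Site d × Fin d) // p.1 ≤ m ∧ p.2 ∈ (ι a).Λb m p.1} =>
        linCovIter L U₀ (iEta (ι a).η A') p.1.1 p.1.2.1 p.1.2.2)) + γ' * B₀ * (α₀ + α₁)))
    (SP5u : ∀ a : J, ∀ α₀ α₁ : ℝ, 0 < α₀ → 0 < α₁ → α₀ + α₁ ≤ cP →
      ∀ U₀ U' : Site d → Fin d → 𝔸ˣ, (∀ x κ, U₀ x κ ∈ unitaryUnits 𝔸) → (∀ x κ, U' x κ ∈ unitaryUnits 𝔸) →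
      ∀ φ : Φ, Adm a φ U₀ α₀ α₁ →
      InAk L (ι a).k (ι a).η α₀ (ι a).Ω U₀ → InAk L (ι a).k (ι a).η α₀ (ι a).Ω (mulCfg U' U₀) → (∀ m, m ≤ (ι a).k → InAx L m ((ι a).Λs m) U₀ (mulCfg U' U₀)) →
      (∀ j, j ≤ (ι a).k → ∀ (z : Site d) (μ : Fin d), (∀ x, InBox (loK L j z) (bondHiK L j z μ) x → x ∈ (ι a).Ω j) →
        ‖(avgIter L (mulCfg U' U₀) j z μ : 𝔸) - (avgIter L U₀ j z μ : 𝔸)‖ ≤ α₁) →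
      (∀ b ∈ {b : Site d × Fin d | SideTouches ((ι a).Ω 0) b.1 b.2}, ‖((U' b.1 b.2 : 𝔸ˣ) : 𝔸) - 1‖ ≤ α₁) →
      ∀ u₁ : Site d → 𝔸ˣ, (∀ x, u₁ x ∈ unitaryUnits 𝔸) → (∀ x, x ∉ (ι a).Ω 0 → u₁ x = 1) → Restr129 L (ι a).k ((ι a).Λs (ι a).k) U₀ u₁ →
      LanF a U₀ φ (ι a).k (mgauge U₀ u₁⁻¹ U') →
      (∃ A₁ : Site d → Fin d → 𝔸, ∀ j, j ≤ (ι a).k → ∀ (x : Site d) (κ : Fin d), SideTouches ((ι a).Ω j) x κ →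
        mgauge U₀ u₁⁻¹ U' x κ = cfgExp (ι a).η A₁ x κ ∧ ‖A₁ x κ‖ ≤ (5 * (d : ℝ) * L * B₈ * (α₀ + α₁)) * ((L : ℝ) ^ j * (ι a).η)⁻¹) →
      ∀ (v w : Site d → 𝔸ˣ) (lam mu : Site d → 𝔸),
      (∀ x, ((gaugeExp lam x : 𝔸ˣ) : 𝔸) = ((v x : 𝔸ˣ) : 𝔸) ∧ IsSelfAdjoint (lam x) ∧ ‖lam x‖ < cu) → (∀ x, x ∉ (ι a).Ω 0 → lam x = 0) →
      (∀ j, j ≤ (ι a).k → ∀ b ∈ {b : Site d × Fin d | SideTouches ((ι a).Ω j) b.1 b.2}, ((L : ℝ) ^ j * (ι a).η) * ‖covDerivFwd (ι a).η U₀ b.2 lam b.1‖ < cu) →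
      (∀ x, ((gaugeExp mu x : 𝔸ˣ) : 𝔸) = ((w x : 𝔸ˣ) : 𝔸) ∧ IsSelfAdjoint (mu x) ∧ ‖mu x‖ < cu) → (∀ x, x ∉ (ι a).Ω 0 → mu x = 0) →
      (∀ j, j ≤ (ι a).k → ∀ b ∈ {b : Site d × Fin d | SideTouches ((ι a).Ω j) b.1 b.2}, ((L : ℝ) ^ j * (ι a).η) * ‖covDerivFwd (ι a).η U₀ b.2 mu b.1‖ < cu) →
      LanF a U₀ φ (ι a).k (mgauge U₀ v⁻¹ (mgauge U₀ u₁⁻¹ U')) → Restr129 L (ι a).k ((ι a).Λs (ι a).k) U₀ (u₁ * v) →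
      LanF a U₀ φ (ι a).k (mgauge U₀ w⁻¹ (mgauge U₀ u₁⁻¹ U')) → Restr129 L (ι a).k ((ι a).Λs (ι a).k) U₀ (u₁ * w) →
      ∀ x, v x = w x) :
    ∃ c₁ : ℝ, 0 < c₁ ∧ ∀ a : J, ∀ α₀ α₁ : ℝ, 0 < α₀ → 0 < α₁ → α₀ + α₁ ≤ c₁ →
      ∀ (U₀ : (zdGF3 𝔸 L β len (ι a)).Cfg) (P : (zdGF3 𝔸 L β len (ι a)).Pert) (φ : Φ), Adm a φ U₀.1 α₀ α₁ →
        (zdGF3 𝔸 L β len (ι a)).InA α₀ U₀ → (zdGF3 𝔸 L β len (ι a)).InAAx α₀ U₀ P → (zdGF3 𝔸 L β len (ι a)).avgClose166 α₁ U₀ P →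
        ∃ u : (zdGF3 𝔸 L β len (ι a)).GT, (zdGF3 𝔸 L β len (ι a)).Restricted U₀ u ∧
          ((zdGF3 𝔸 L β len (ι a)).C137 α₁ U₀ ((zdGF3 𝔸 L β len (ι a)).act P u) ∧
            LanF a U₀.1 φ (ι a).k ((zdGF3 𝔸 L β len (ι a)).act P u).2.1 ∧
            (zdGF3 𝔸 L β len (ι a)).C162 (5 * (d : ℝ) * L * B₈) (α₀ + α₁) U₀ ((zdGF3 𝔸 L β len (ι a)).act P u)) ∧
          ∀ u' : (zdGF3 𝔸 L β len (ι a)).GT, (zdGF3 𝔸 L β len (ι a)).Restricted U₀ u' →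
            LanF a U₀.1 φ (ι a).k ((zdGF3 𝔸 L β len (ι a)).act P u').2.1 →
            (zdGF3 𝔸 L β len (ι a)).C162 (5 * (d : ℝ) * L * B₈) (α₀ + α₁) U₀ ((zdGF3 𝔸 L β len (ι a)).act P u') → u' = u := by
  obtain ⟨c₁, hc₁, H⟩ := thm4Core_zd3_lanE (𝔸 := 𝔸) (β := β) (len := len) hd2 hL hB₀ hB₀' hcu hcP (Φ := J × Φ) hγ' hB₈ hB₀8 hB
    hγB (fun i p U₀ a0 b0 => ι p.1 = i ∧ Adm p.1 p.2 U₀ a0 b0) (fun i U₀ p m W => LanF p.1 U₀ p.2 m W)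
    (by
      intro i α₀ α₁ hα₀ hα₁ hs U₀ U' hU₀ hU' p hp
      obtain ⟨hi, hφ⟩ := hp
      subst hi
      exact SP5base p.1 α₀ α₁ hα₀ hα₁ hs U₀ U' hU₀ hU' p.2 hφ)
    (by
      intro i α₀ α₁ hα₀ hα₁ hs U₀ U' hU₀ hU' p hp
      obtain ⟨hi, hφ⟩ := hp
      subst hi
      exact SP5 p.1 α₀ α₁ hα₀ hα₁ hs U₀ U' hU₀ hU' p.2 hφ)
    (by
      intro i α₀ α₁ hα₀ hα₁ hs U₀ U' hU₀ hU' p hp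
      obtain ⟨hi, hφ⟩ := hp
      subst hi
      exact SH59src p.1 α₀ α₁ hα₀ hα₁ hs U₀ U' hU₀ hU' p.2 hφ)
    (by
      intro i α₀ α₁ hα₀ hα₁ hs U₀ U' hU₀ hU' p hp
      obtain ⟨hi, hφ⟩ := hp
      subst hi
      exact SP5u p.1 α₀ α₁ hα₀ hα₁ hs U₀ U' hU₀ hU' p.2 hφ)
  exact ⟨c₁, hc₁, fun a α₀ α₁ hα₀ hα₁ hs U₀ P φ hφ => H (ι a) α₀ α₁ hα₀ hα₁ hs U₀ P (a, φ) ⟨rfl, hφ⟩⟩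

end Core

/-! ## §2 Theorem 8 surviving on `zdGF3H ∘ ι`, E currency -/

section Thm8

variable {𝔸 : Type} [CStarAlgebra 𝔸] [Nontrivial 𝔸]

/-- ★ **THEOREM 8 IN ITS SURVIVING FORM ON THE `Ω₀ = ℤᵈ` MEMBERS OF THE REPAIRED CARRIER `zdGF3H`, OVER AN INDEX MAP, MODULO THE SOURCED SOCKETS AT `ι a`** —
n05-c g5's `thm8SurvivingAt_zd3H_univ_lan` for any `ι : J → ZdIdx d L` onto `Ω₀ = ℤᵈ` members, the five sourced sockets (source premiss ρ2: `φ ∈ R(U₀)`, Hermitian, `= 0` off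
`Ω₀`, `Bdd`, `|φ|₍₋₂₎ < γ(α₀ + α₁)`) and `hLanF` demanded `∀ a : J` AT `ι a` ONLY.  Proof = n05-c's verbatim with `i.1 ↦ ι a`, core `thm4Core_zd3_map_lan`.
[cite: Balaban1985RegularSpaces, Thm 8 (1.146) p.101, Thm 2 p.83, Thm 4 p.88, Prop. 3 p.87, (1.65)–(1.66) pp.87–88, (1.42) p.83, p.77] -/
theorem thm8SurvivingAt_zd3H_map_lanE (hd2 : 2 ≤ d) {L : ℕ} (hL : 2 ≤ L) {β : ℝ} {len : Site d → ℝ}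
    {B₀ B₀' B₀β cu cP cP3 γ γ' B₈ : ℝ} (hB₀ : 0 < B₀) (hB₀' : 0 < B₀') (hcu : 0 < cu) (hcP : 0 < cP) (hcP3 : 0 < cP3)
    (hγ : 0 < γ) (hγ' : 0 ≤ γ') (hB₈ : 0 < B₈) (hB₀8 : B₀ ≤ B₈) (hB : 2 ≤ 5 * (d : ℝ) * L * B₈)
    (hγB : 5 * (d : ℝ) * L * B₀ + 2 * (γ' * B₀) ≤ 5 * (d : ℝ) * L * B₈)
    {J : Type} (ι : J → ZdIdx d L) (hΩ0 : ∀ a : J, (ι a).Ω 0 = Set.univ)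
    (LanF : J → (Site d → Fin d → 𝔸ˣ) → (Site d → 𝔸) → ℕ → (Site d → Fin d → 𝔸ˣ) → Prop)
    (hLanF : ∀ (a : J) (U₀ : Site d → Fin d → 𝔸ˣ) (f : Site d → 𝔸) (W : Site d → Fin d → 𝔸ˣ),
      LanF a U₀ f (ι a).k W ↔ IsLandau146W L (ι a).k (ι a).η ((ι a).Ω 0) ((ι a).Λs (ι a).k) U₀ f W)
    (SP5base : ∀ a : J, ∀ α₀ α₁ : ℝ, 0 < α₀ → 0 < α₁ → α₀ + α₁ ≤ cP →
      ∀ U₀ U' : Site d → Fin d → 𝔸ˣ, (∀ x κ, U₀ x κ ∈ unitaryUnits 𝔸) → (∀ x κ, U' x κ ∈ unitaryUnits 𝔸) →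
      ∀ φ : Site d → 𝔸, ((InR138 L (ι a).k (ι a).η ((ι a).Ω 0) ((ι a).Λs (ι a).k) U₀ φ ∧ (∀ x, IsSelfAdjoint (φ x)) ∧ (∀ x, x ∉ (ι a).Ω 0 → φ x = 0) ∧
          Bdd L (ι a).k (ι a).η (-(2 : ℝ)) (fun j (x : Site d) => x ∈ (ι a).Ω j) φ) ∧
        msup L (ι a).k (ι a).η (-(2 : ℝ)) (fun j (x : Site d) => x ∈ (ι a).Ω j) φ < γ * (α₀ + α₁)) →
      InAk L (ι a).k (ι a).η α₀ (ι a).Ω U₀ → InAk L (ι a).k (ι a).η α₀ (ι a).Ω (mulCfg U' U₀) → (∀ m, m ≤ (ι a).k → InAx L m ((ι a).Λs m) U₀ (mulCfg U' U₀)) →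
      (∀ j, j ≤ (ι a).k → ∀ (z : Site d) (μ : Fin d), (∀ x, InBox (loK L j z) (bondHiK L j z μ) x → x ∈ (ι a).Ω j) →
        ‖(avgIter L (mulCfg U' U₀) j z μ : 𝔸) - (avgIter L U₀ j z μ : 𝔸)‖ ≤ α₁) →
      (∀ b ∈ {b : Site d × Fin d | SideTouches ((ι a).Ω 0) b.1 b.2}, ‖((U' b.1 b.2 : 𝔸ˣ) : 𝔸) - 1‖ ≤ α₁) →
      (∃ (v : Site d → 𝔸ˣ) (lam : Site d → 𝔸), (∀ x, v x ∈ unitaryUnits 𝔸) ∧ (∀ x, x ∉ (ι a).Ω 0 → v x = 1) ∧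
        (∀ j, j ≤ 1 → ∀ b ∈ {b : Site d × Fin d | SideTouches ((ι a).Ω j) b.1 b.2}, (v b.1 : 𝔸) = ((gaugeExp lam b.1 : 𝔸ˣ) : 𝔸) ∧
        (v (b.1 + e b.2) : 𝔸) = ((gaugeExp lam (b.1 + e b.2) : 𝔸ˣ) : 𝔸)) ∧
        (∀ j, j ≤ 1 → ∀ b ∈ {b : Site d × Fin d | SideTouches ((ι a).Ω j) b.1 b.2},
        ‖lam b.1‖ ≤ (8 * B₀' * (5 * (d : ℝ) * L * B₈) * (α₀ + α₁)) ∧ ((L : ℝ) ^ j * (ι a).η) * ‖covDerivFwd (ι a).η U₀ b.2 lam b.1‖ ≤ (8 * B₀' * (5 * (d : ℝ) * L * B₈) * (α₀ + α₁))) ∧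
        LanF a U₀ φ 1 (mgauge U₀ v⁻¹ U') ∧ Restr129 L 1 ((ι a).Λs 1) U₀ ((1 : Site d → 𝔸ˣ) * v)))
    (SP5 : ∀ a : J, ∀ α₀ α₁ : ℝ, 0 < α₀ → 0 < α₁ → α₀ + α₁ ≤ cP →
      ∀ U₀ U' : Site d → Fin d → 𝔸ˣ, (∀ x κ, U₀ x κ ∈ unitaryUnits 𝔸) → (∀ x κ, U' x κ ∈ unitaryUnits 𝔸) →
      ∀ φ : Site d → 𝔸, ((InR138 L (ι a).k (ι a).η ((ι a).Ω 0) ((ι a).Λs (ι a).k) U₀ φ ∧ (∀ x, IsSelfAdjoint (φ x)) ∧ (∀ x, x ∉ (ι a).Ω 0 → φ x = 0) ∧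
          Bdd L (ι a).k (ι a).η (-(2 : ℝ)) (fun j (x : Site d) => x ∈ (ι a).Ω j) φ) ∧
        msup L (ι a).k (ι a).η (-(2 : ℝ)) (fun j (x : Site d) => x ∈ (ι a).Ω j) φ < γ * (α₀ + α₁)) →
      InAk L (ι a).k (ι a).η α₀ (ι a).Ω U₀ → InAk L (ι a).k (ι a).η α₀ (ι a).Ω (mulCfg U' U₀) → (∀ m, m ≤ (ι a).k → InAx L m ((ι a).Λs m) U₀ (mulCfg U' U₀)) →
      (∀ j, j ≤ (ι a).k → ∀ (z : Site d) (μ : Fin d), (∀ x, InBox (loK L j z) (bondHiK L j z μ) x → x ∈ (ι a).Ω j) →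
        ‖(avgIter L (mulCfg U' U₀) j z μ : 𝔸) - (avgIter L U₀ j z μ : 𝔸)‖ ≤ α₁) →
      (∀ b ∈ {b : Site d × Fin d | SideTouches ((ι a).Ω 0) b.1 b.2}, ‖((U' b.1 b.2 : 𝔸ˣ) : 𝔸) - 1‖ ≤ α₁) →
      (∀ m, 1 ≤ m → m < (ι a).k → ∀ (u₁ : Site d → 𝔸ˣ) (U₁ : Site d → Fin d → 𝔸ˣ) (A : Site d → Fin d → 𝔸),
        (∀ x, u₁ x ∈ unitaryUnits 𝔸) → (∀ x, x ∉ (ι a).Ω 0 → u₁ x = 1) → mgauge U₀ u₁ U₁ = U' → Restr129 L m ((ι a).Λs m) U₀ u₁ →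
        LanF a U₀ φ m U₁ →
        (∀ j, j ≤ m → ∀ b ∈ {b : Site d × Fin d | SideTouches ((ι a).Ω j) b.1 b.2},
        U₁ b.1 b.2 = cfgExp (ι a).η A b.1 b.2 ∧ IsSelfAdjoint (A b.1 b.2) ∧ ‖A b.1 b.2‖ ≤ (5 * (d : ℝ) * L * B₈ * (α₀ + α₁)) * ((L : ℝ) ^ j * (ι a).η)⁻¹) →
        ∃ (v : Site d → 𝔸ˣ) (lam : Site d → 𝔸), (∀ x, v x ∈ unitaryUnits 𝔸) ∧ (∀ x, x ∉ (ι a).Ω 0 → v x = 1) ∧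
        (∀ j, j ≤ m + 1 → ∀ b ∈ {b : Site d × Fin d | SideTouches ((ι a).Ω j) b.1 b.2}, (v b.1 : 𝔸) = ((gaugeExp lam b.1 : 𝔸ˣ) : 𝔸) ∧
        (v (b.1 + e b.2) : 𝔸) = ((gaugeExp lam (b.1 + e b.2) : 𝔸ˣ) : 𝔸)) ∧
        (∀ j, j ≤ m + 1 → ∀ b ∈ {b : Site d × Fin d | SideTouches ((ι a).Ω j) b.1 b.2},
        ‖lam b.1‖ ≤ (8 * B₀' * (5 * (d : ℝ) * L * B₈) * (α₀ + α₁)) ∧ ((L : ℝ) ^ j * (ι a).η) * ‖covDerivFwd (ι a).η U₀ b.2 lam b.1‖ ≤ (8 * B₀' * (5 * (d : ℝ) * L * B₈) * (α₀ + α₁))) ∧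
        LanF a U₀ φ (m + 1) (mgauge U₀ v⁻¹ U₁) ∧ Restr129 L (m + 1) ((ι a).Λs (m + 1)) U₀ (u₁ * v)))
    (SH59src : ∀ a : J, ∀ α₀ α₁ : ℝ, 0 < α₀ → 0 < α₁ → α₀ + α₁ ≤ cP →
      ∀ U₀ U' : Site d → Fin d → 𝔸ˣ, (∀ x κ, U₀ x κ ∈ unitaryUnits 𝔸) → (∀ x κ, U' x κ ∈ unitaryUnits 𝔸) →
      ∀ φ : Site d → 𝔸, ((InR138 L (ι a).k (ι a).η ((ι a).Ω 0) ((ι a).Λs (ι a).k) U₀ φ ∧ (∀ x, IsSelfAdjoint (φ x)) ∧ (∀ x, x ∉ (ι a).Ω 0 → φ x = 0) ∧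
          Bdd L (ι a).k (ι a).η (-(2 : ℝ)) (fun j (x : Site d) => x ∈ (ι a).Ω j) φ) ∧
        msup L (ι a).k (ι a).η (-(2 : ℝ)) (fun j (x : Site d) => x ∈ (ι a).Ω j) φ < γ * (α₀ + α₁)) →
      InAk L (ι a).k (ι a).η α₀ (ι a).Ω U₀ → InAk L (ι a).k (ι a).η α₀ (ι a).Ω (mulCfg U' U₀) → (∀ m, m ≤ (ι a).k → InAx L m ((ι a).Λs m) U₀ (mulCfg U' U₀)) →
      (∀ j, j ≤ (ι a).k → ∀ (z : Site d) (μ : Fin d), (∀ x, InBox (loK L j z) (bondHiK L j z μ) x → x ∈ (ι a).Ω j) →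
        ‖(avgIter L (mulCfg U' U₀) j z μ : 𝔸) - (avgIter L U₀ j z μ : 𝔸)‖ ≤ α₁) →
      (∀ b ∈ {b : Site d × Fin d | SideTouches ((ι a).Ω 0) b.1 b.2}, ‖((U' b.1 b.2 : 𝔸ˣ) : 𝔸) - 1‖ ≤ α₁) →
      (∀ m, 1 ≤ m → m ≤ (ι a).k → ∀ (u : Site d → 𝔸ˣ) (W : Site d → Fin d → 𝔸ˣ) (A' : Site d → Fin d → 𝔸),
        (∀ x, u x ∈ unitaryUnits 𝔸) → mgauge U₀ u W = U' → Restr129 L m ((ι a).Λs m) U₀ u → LanF a U₀ φ m W →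
        (∀ y τ, IsSelfAdjoint (A' y τ)) →
        (∀ j, j ≤ m → ∀ y τ, SideTouches ((ι a).Ω j) y τ →
        W y τ = cfgExp (ι a).η A' y τ ∧ ‖A' y τ‖ ≤ (2 * (L * (5 * (d : ℝ) * L * B₈ * (α₀ + α₁))) + 8 * (8 * B₀' * (5 * (d : ℝ) * L * B₈) * (α₀ + α₁))) * ((L : ℝ) ^ j * (ι a).η)⁻¹) →
        (∀ y τ, (∀ j, j ≤ m → ¬ SideTouches ((ι a).Ω j) y τ) → A' y τ = 0) →
        msup L m (ι a).η (-(1 : ℝ)) (fun j (b : Site d × Fin d) => SideTouches ((ι a).Ω j) b.1 b.2) (fun b => A' b.1 b.2)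
        ≤ B₀ * (bondNorm L m (ι a).η (-(3 : ℝ)) (ι a).Ω (fun x μ => Jcur (ι a).η U₀ A' μ x)
        + wsup 1 (fun p : {p : ℕ × (Site d × Fin d) // p.1 ≤ m ∧ p.2 ∈ (ι a).Λb m p.1} =>
        linCovIter L U₀ (iEta (ι a).η A') p.1.1 p.1.2.1 p.1.2.2)) + γ' * B₀ * (α₀ + α₁) ∧
        msup L m (ι a).η (-(2 : ℝ)) (fun j (t : Fin d × Fin d × Site d) => SideTouches ((ι a).Ω j) t.2.2 t.2.1)
        (fun t => covDerivFwd (ι a).η U₀ t.1 (fun z => A' z t.2.1) t.2.2)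
        ≤ B₀ * (bondNorm L m (ι a).η (-(3 : ℝ)) (ι a).Ω (fun x μ => Jcur (ι a).η U₀ A' μ x)
        + wsup 1 (fun p : {p : ℕ × (Site d × Fin d) // p.1 ≤ m ∧ p.2 ∈ (ι a).Λb m p.1} =>
        linCovIter L U₀ (iEta (ι a).η A') p.1.1 p.1.2.1 p.1.2.2)) + γ' * B₀ * (α₀ + α₁)))
    (SP5u : ∀ a : J, ∀ α₀ α₁ : ℝ, 0 < α₀ → 0 < α₁ → α₀ + α₁ ≤ cP →
      ∀ U₀ U' : Site d → Fin d → 𝔸ˣ, (∀ x κ, U₀ x κ ∈ unitaryUnits 𝔸) → (∀ x κ, U' x κ ∈ unitaryUnits 𝔸) →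
      ∀ φ : Site d → 𝔸, ((InR138 L (ι a).k (ι a).η ((ι a).Ω 0) ((ι a).Λs (ι a).k) U₀ φ ∧ (∀ x, IsSelfAdjoint (φ x)) ∧ (∀ x, x ∉ (ι a).Ω 0 → φ x = 0) ∧
          Bdd L (ι a).k (ι a).η (-(2 : ℝ)) (fun j (x : Site d) => x ∈ (ι a).Ω j) φ) ∧
        msup L (ι a).k (ι a).η (-(2 : ℝ)) (fun j (x : Site d) => x ∈ (ι a).Ω j) φ < γ * (α₀ + α₁)) →
      InAk L (ι a).k (ι a).η α₀ (ι a).Ω U₀ → InAk L (ι a).k (ι a).η α₀ (ι a).Ω (mulCfg U' U₀) → (∀ m, m ≤ (ι a).k → InAx L m ((ι a).Λs m) U₀ (mulCfg U' U₀)) →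
      (∀ j, j ≤ (ι a).k → ∀ (z : Site d) (μ : Fin d), (∀ x, InBox (loK L j z) (bondHiK L j z μ) x → x ∈ (ι a).Ω j) →
        ‖(avgIter L (mulCfg U' U₀) j z μ : 𝔸) - (avgIter L U₀ j z μ : 𝔸)‖ ≤ α₁) →
      (∀ b ∈ {b : Site d × Fin d | SideTouches ((ι a).Ω 0) b.1 b.2}, ‖((U' b.1 b.2 : 𝔸ˣ) : 𝔸) - 1‖ ≤ α₁) →
      ∀ u₁ : Site d → 𝔸ˣ, (∀ x, u₁ x ∈ unitaryUnits 𝔸) → (∀ x, x ∉ (ι a).Ω 0 → u₁ x = 1) → Restr129 L (ι a).k ((ι a).Λs (ι a).k) U₀ u₁ →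
      LanF a U₀ φ (ι a).k (mgauge U₀ u₁⁻¹ U') →
      (∃ A₁ : Site d → Fin d → 𝔸, ∀ j, j ≤ (ι a).k → ∀ (x : Site d) (κ : Fin d), SideTouches ((ι a).Ω j) x κ →
        mgauge U₀ u₁⁻¹ U' x κ = cfgExp (ι a).η A₁ x κ ∧ ‖A₁ x κ‖ ≤ (5 * (d : ℝ) * L * B₈ * (α₀ + α₁)) * ((L : ℝ) ^ j * (ι a).η)⁻¹) →
      ∀ (v w : Site d → 𝔸ˣ) (lam mu : Site d → 𝔸),
      (∀ x, ((gaugeExp lam x : 𝔸ˣ) : 𝔸) = ((v x : 𝔸ˣ) : 𝔸) ∧ IsSelfAdjoint (lam x) ∧ ‖lam x‖ < cu) → (∀ x, x ∉ (ι a).Ω 0 → lam x = 0) →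
      (∀ j, j ≤ (ι a).k → ∀ b ∈ {b : Site d × Fin d | SideTouches ((ι a).Ω j) b.1 b.2}, ((L : ℝ) ^ j * (ι a).η) * ‖covDerivFwd (ι a).η U₀ b.2 lam b.1‖ < cu) →
      (∀ x, ((gaugeExp mu x : 𝔸ˣ) : 𝔸) = ((w x : 𝔸ˣ) : 𝔸) ∧ IsSelfAdjoint (mu x) ∧ ‖mu x‖ < cu) → (∀ x, x ∉ (ι a).Ω 0 → mu x = 0) →
      (∀ j, j ≤ (ι a).k → ∀ b ∈ {b : Site d × Fin d | SideTouches ((ι a).Ω j) b.1 b.2}, ((L : ℝ) ^ j * (ι a).η) * ‖covDerivFwd (ι a).η U₀ b.2 mu b.1‖ < cu) →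
      LanF a U₀ φ (ι a).k (mgauge U₀ v⁻¹ (mgauge U₀ u₁⁻¹ U')) → Restr129 L (ι a).k ((ι a).Λs (ι a).k) U₀ (u₁ * v) →
      LanF a U₀ φ (ι a).k (mgauge U₀ w⁻¹ (mgauge U₀ u₁⁻¹ U')) → Restr129 L (ι a).k ((ι a).Λs (ι a).k) U₀ (u₁ * w) →
      ∀ x, v x = w x)
    (SP3src : ∀ a : J, ∀ α₀ α₁ α₂ : ℝ, 0 < α₀ → α₀ ≤ cP3 → 0 < α₁ → α₁ ≤ cP3 → 0 < α₂ → α₂ ≤ cP3 →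
      2 * α₂ ^ 2 + 20 * d * α₀ * α₂ + 2 * (2097152 * ((d : ℝ) + 1) ^ 2) * α₂ ^ 2 ≤ α₀ + α₁ →
      ∀ (U₀ : (zdGF3H 𝔸 L β len (ι a)).Cfg) (P' : (zdGF3H 𝔸 L β len (ι a)).Pert) (f : Site d → 𝔸),
        (zdGF3H 𝔸 L β len (ι a)).InR U₀ f → (zdGF3H 𝔸 L β len (ι a)).fNorm f < γ * (α₀ + α₁) → (zdGF3H 𝔸 L β len (ι a)).fGrad U₀ f < γ * (α₀ + α₁) →
        (zdGF3H 𝔸 L β len (ι a)).InA α₀ U₀ → (zdGF3H 𝔸 L β len (ι a)).InAPair α₀ U₀ P' → (zdGF3H 𝔸 L β len (ι a)).C162 1 α₂ U₀ P' →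
        (zdGF3H 𝔸 L β len (ι a)).LandauF U₀ f P' → (zdGF3H 𝔸 L β len (ι a)).C137 α₁ U₀ P' →
        (zdGF3H 𝔸 L β len (ι a)).C136 (5 * d * L * B₈) (5 * d * L * B₀β) (α₀ + α₁) U₀ P' ∧
          (zdGF3H 𝔸 L β len (ι a)).C139 (5 * d * L * B₈) (α₀ + α₁) U₀ P') :
    B8Thm8Surviving.Thm8SurvivingAt γ (5 * (d : ℝ) * L * B₈ * (1 + 11 * (d : ℝ) ^ 2)) (5 * (d : ℝ) * L * B₀β * (1 + 11 * (d : ℝ) ^ 2))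
      (fun a : J => zdGF3H 𝔸 L β len (ι a)) := by
  have hL1 : 1 ≤ L := le_trans (by norm_num) hL
  have hd1 : 1 ≤ d := le_trans (by norm_num) hd2
  have hL' : (1 : ℝ) ≤ L := by exact_mod_cast hL1
  have hd' : (1 : ℝ) ≤ d := by exact_mod_cast hd1
  -- the Theorem-4-shaped core at the source-indexed gauge predicate, the windows
  obtain ⟨c4, hc4, H4⟩ := thm4Core_zd3_map_lanE (𝔸 := 𝔸) (β := β) (len := len) hd2 hL hB₀ hB₀' hcu hcP (Φ := Site d → 𝔸) hγ' hB₈ hB₀8 hB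
    hγB ι (fun a f U₀ a0 b0 => (InR138 L (ι a).k (ι a).η ((ι a).Ω 0) ((ι a).Λs (ι a).k) U₀ f ∧ (∀ x, IsSelfAdjoint (f x)) ∧ (∀ x, x ∉ (ι a).Ω 0 → f x = 0) ∧
        Bdd L (ι a).k (ι a).η (-(2 : ℝ)) (fun j (x : Site d) => x ∈ (ι a).Ω j) f) ∧
      msup L (ι a).k (ι a).η (-(2 : ℝ)) (fun j (x : Site d) => x ∈ (ι a).Ω j) f < γ * (a0 + b0)) LanF SP5base SP5 SH59src SP5u
  obtain ⟨cw, hcw, hw⟩ := thm4_windows hd1 hL1 hB₈ hB₀' hB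
  obtain ⟨cw', hcw', hw'⟩ := thm4_windows_extra (d := d) hL1
  -- constants
  set D : ℝ := 1 + 11 * (d : ℝ) ^ 2 with hD_def
  have hD1 : 1 ≤ D := le_add_of_nonneg_right (by positivity)
  have hD0 : 0 < D := lt_of_lt_of_le one_pos hD1
  have hDne : D ≠ 0 := hD0.ne'
  have hK₁ : 0 < 5 * (d : ℝ) * L * B₈ := by positivity
  have hK₁D : 0 < 5 * (d : ℝ) * L * B₈ * D := mul_pos hK₁ hD0
  -- the threshold
  set cT : ℝ := min (min (c4 / D) (min (cw / D) (cw' / D)))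
    (min (min (cP3 / D) (cP3 / (5 * (d : ℝ) * L * B₈ * D))) (1 / (6 * D))) with hcT_def
  have hcT : 0 < cT :=
    lt_min (lt_min (div_pos hc4 hD0) (lt_min (div_pos hcw hD0) (div_pos hcw' hD0)))
      (lt_min (lt_min (div_pos hcP3 hD0) (div_pos hcP3 hK₁D)) (by positivity))
  refine ⟨cT, hcT, ?_⟩
  intro a α₀ α₁ hα₀ hα₁ hs U₀ P f hInA hReg hInAAx havg hInR hf
  have hS0 : 0 < α₀ + α₁ := add_pos hα₀ hα₁
  -- unpack the thresholds
  have hle : ∀ {c : ℝ}, cT ≤ c / D → D * (α₀ + α₁) ≤ c := by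
    intro c hc
    have h1 : α₀ + α₁ ≤ c / D := hs.trans hc
    calc D * (α₀ + α₁) ≤ D * (c / D) := mul_le_mul_of_nonneg_left h1 hD0.le
      _ = c := by field_simp
  have hs4 : D * (α₀ + α₁) ≤ c4 := hle ((min_le_left _ _).trans (min_le_left _ _))
  have hsw : D * (α₀ + α₁) ≤ cw := hle ((min_le_left _ _).trans ((min_le_right _ _).trans (min_le_left _ _)))
  have hsw' : D * (α₀ + α₁) ≤ cw' := hle ((min_le_left _ _).trans ((min_le_right _ _).trans (min_le_right _ _)))
  have hs3 : D * (α₀ + α₁) ≤ cP3 := hle ((min_le_right _ _).trans ((min_le_left _ _).trans (min_le_left _ _)))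
  have hs3' : 5 * (d : ℝ) * L * B₈ * D * (α₀ + α₁) ≤ cP3 := by
    have h1 : α₀ + α₁ ≤ cP3 / (5 * (d : ℝ) * L * B₈ * D) :=
      hs.trans ((min_le_right _ _).trans ((min_le_left _ _).trans (min_le_right _ _)))
    calc 5 * (d : ℝ) * L * B₈ * D * (α₀ + α₁) ≤ 5 * (d : ℝ) * L * B₈ * D * (cP3 / (5 * (d : ℝ) * L * B₈ * D)) :=
        mul_le_mul_of_nonneg_left h1 hK₁D.le
      _ = cP3 := by field_simp
  have hs6 : D * (α₀ + α₁) ≤ 1 / 6 := by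
    have h1 : α₀ + α₁ ≤ 1 / (6 * D) := hs.trans ((min_le_right _ _).trans (min_le_right _ _))
    calc D * (α₀ + α₁) ≤ D * (1 / (6 * D)) := mul_le_mul_of_nonneg_left h1 hD0.le
      _ = 1 / 6 := by field_simp
  -- the shifted pair `(α₀, α″)`
  set α'' : ℝ := 11 * (d : ℝ) ^ 2 * (α₀ + α₁) + α₁ with hα''_def
  have h11 : 0 ≤ 11 * (d : ℝ) ^ 2 * (α₀ + α₁) := by positivity
  have h11' : 0 ≤ 11 * (d : ℝ) ^ 2 * α₁ := by positivity
  have hα'' : 0 < α'' := by rw [hα''_def]; linarith only [h11, hα₁]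
  have hsum : α₀ + α'' = D * (α₀ + α₁) := by simp only [hα''_def, hD_def]; ring
  have hα₁'' : α₁ ≤ α'' := by rw [hα''_def]; linarith only [h11]
  have h165 : 11 * (d : ℝ) ^ 2 * α₀ + α₁ ≤ α'' := by rw [hα''_def]; linarith only [h11']
  have hSS : α₀ + α₁ ≤ α₀ + α'' := by linarith only [hα₁'']
  -- windows at the shifted pair
  obtain ⟨-, -, -, -, w5, w6, w7, -, w9, w10, -, -, -, w14, -, -, -, -⟩ :=
    hw α₀ α'' hα₀ hα'' (hsum ▸ hsw) (5 * (d : ℝ) * L * B₈ * (α₀ + α'')) (8 * B₀' * (5 * (d : ℝ) * L * B₈) * (α₀ + α'')) rfl rfl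
  obtain ⟨w19, -⟩ := hw' α₀ α'' hα₀ hα'' (hsum ▸ hsw')
  have hsmall₁ : (d : ℝ) * L * α₁ ≤ 1 / 8 := (mul_le_mul_of_nonneg_left hα₁'' (by positivity)).trans w19
  have hα2 : 2 * α₀ ≤ c2' d L := by linarith only [w6, hα₀]
  -- the data
  obtain ⟨hP1, h34, hAx⟩ := hInAAx
  subst hP1
  -- (1.66)₀ on all bonds (Ω₀ = ℤᵈ): (1.65)
  have hpart' : ∀ x : Site d, ∃ j, j ≤ (ι a).k ∧ ∃ y ∈ (ι a).Λs (ι a).k j, InBox (tlo L y j) (thi L y j) x := by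
    intro x
    have hx : x ∈ (ι a).Ω 0 := by rw [hΩ0 a]; trivial
    exact (ι a).hpart x hx
  have hsm : 11 * (d : ℝ) ^ 2 * α₀ + α₁ ≤ 1 / 6 := by linarith only [h165, hα₀, hsum, hs6]
  have h66 : ∀ b ∈ {b : Site d × Fin d | SideTouches ((ι a).Ω 0) b.1 b.2}, ‖((P.2.1 b.1 b.2 : 𝔸ˣ) : 𝔸) - 1‖ ≤ α'' := by
    intro b _
    have h := norm_pert_sub_one_le_univ hd1 hL (ι a).k (η := (ι a).η) P.1.2 P.2.2 hα₀ w5 hα2 hα₁.le hsm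
      (ι a).Ω (ι a).hΩ ((ι a).Λs (ι a).k) (ι a).htower hpart' hInA h34 (hAx (ι a).k le_rfl) havg b.1 b.2
    exact h.trans h165
  have h166 : (zdGF3H 𝔸 L β len (ι a)).avgClose166 α'' P.1 P :=
    ⟨fun j hj z μ hb => (havg j hj z μ hb).trans hα₁'', h66⟩
  -- the source is admitted at the shifted pair
  have hfS : msup L (ι a).k (ι a).η (-(2 : ℝ)) (fun j (x : Site d) => x ∈ (ι a).Ω j) f < γ * (α₀ + α'') :=
    lt_of_lt_of_le hf (mul_le_mul_of_nonneg_left hSS hγ.le)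
  -- THE THEOREM-4-SHAPED CORE at the shifted pair
  obtain ⟨u, hR, ⟨h137'', hLan, h162⟩, huniq⟩ :=
    H4 a α₀ α'' hα₀ hα'' (hsum ▸ hs4) P.1 P f ⟨hInR, hfS⟩ hInA ⟨rfl, h34, hAx⟩ h166
  have hLF : (zdGF3H 𝔸 L β len (ι a)).LandauF P.1 f ((zdGF3H 𝔸 L β len (ι a)).act P u) := (hLanF a P.1.1 f _).1 hLan
  have hcs0 : 0 ≤ 5 * (d : ℝ) * L * B₈ * (α₀ + α'') := by positivity
  -- PROPOSITION 3 WITH SOURCE at (α₀, α″, α₂ := c⋆″) for the gauge-fixed field (socket), under the inspected size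
  have hSD : α₀ + α₁ ≤ D * (α₀ + α₁) := le_mul_of_one_le_left hS0.le hD1
  have hα₀3 : α₀ ≤ cP3 := by linarith only [hα₁, hSD, hs3]
  have hα''3 : α'' ≤ cP3 := by linarith only [hα₀, hsum, hs3]
  have hcs3 : 5 * (d : ℝ) * L * B₈ * (α₀ + α'') ≤ cP3 := by
    rw [hsum, ← mul_assoc]; exact hs3'
  have hcspos : 0 < 5 * (d : ℝ) * L * B₈ * (α₀ + α'') := by positivity
  have hKS0 : 0 ≤ 2 * (L * (5 * (d : ℝ) * L * B₈ * (α₀ + α''))) + 8 * (8 * B₀' * (5 * (d : ℝ) * L * B₈) * (α₀ + α'')) := by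
    positivity
  have hcK : 5 * (d : ℝ) * L * B₈ * (α₀ + α'') ≤
      2 * (L * (5 * (d : ℝ) * L * B₈ * (α₀ + α''))) + 8 * (8 * B₀' * (5 * (d : ℝ) * L * B₈) * (α₀ + α'')) := by
    have h₁ : (1 : ℝ) * (5 * (d : ℝ) * L * B₈ * (α₀ + α'')) ≤ L * (5 * (d : ℝ) * L * B₈ * (α₀ + α'')) :=
      mul_le_mul_of_nonneg_right hL' hcs0
    have h₂ : 0 ≤ 8 * (8 * B₀' * (5 * (d : ℝ) * L * B₈) * (α₀ + α'')) := by positivity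
    linarith only [h₁, h₂, hcs0]
  have h61 : 2 * (5 * (d : ℝ) * L * B₈ * (α₀ + α'')) ^ 2 + 20 * d * α₀ * (5 * (d : ℝ) * L * B₈ * (α₀ + α'')) +
      2 * (2097152 * ((d : ℝ) + 1) ^ 2) * (5 * (d : ℝ) * L * B₈ * (α₀ + α'')) ^ 2 ≤ α₀ + α'' := by
    set c := 5 * (d : ℝ) * L * B₈ * (α₀ + α'') with hc
    set K := 2 * (L * c) + 8 * (8 * B₀' * (5 * (d : ℝ) * L * B₈) * (α₀ + α'')) with hK
    have hcKle : c ≤ K := hcK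
    have hc0 : 0 ≤ c := hcs0
    have hC : (2 : ℝ) * (16 * (131072 * ((d : ℝ) + 1) ^ 2)) = 2 * (2097152 * ((d : ℝ) + 1) ^ 2) := by ring
    rw [← hC]
    have hmono : 2 * c ^ 2 + 20 * d * α₀ * c + 2 * (16 * (131072 * ((d : ℝ) + 1) ^ 2)) * c ^ 2 ≤
        2 * K ^ 2 + 20 * d * α₀ * K + 2 * (16 * (131072 * ((d : ℝ) + 1) ^ 2)) * K ^ 2 := by
      have h1 : c ^ 2 ≤ K ^ 2 := pow_le_pow_left₀ hc0 hcKle 2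
      have h2 : 0 ≤ 20 * (d : ℝ) * α₀ := by positivity
      have h3 : 0 ≤ 2 * (16 * (131072 * ((d : ℝ) + 1) ^ 2)) := by positivity
      have h4 := mul_le_mul_of_nonneg_left hcKle h2
      have h5 := mul_le_mul_of_nonneg_left h1 h3
      linarith only [h1, h4, h5]
    exact hmono.trans w14
  have hu : ∀ x, u.1 x ∈ unitaryUnits 𝔸 := u.2.1
  have hW : mgauge P.1.1 u.1 (mgauge P.1.1 u.1⁻¹ P.2.1) = P.2.1 := B8Thm4AtLandau138.mgauge_mgauge_inv P.1.1 P.2.1 u.1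
  -- (1.37) at the ORIGINAL `α₁`: the (1.42) lemma on the canonical exponent of the gauge-fixed field (as in `thm2Printed_zd3_univ`)
  have hc16 : 16 * (5 * (d : ℝ) * L * B₈ * (α₀ + α'')) ≤ 1 := by linarith only [w7, hcK, hKS0]
  have hWu : ∀ x κ, mgauge P.1.1 u.1⁻¹ P.2.1 x κ ∈ unitaryUnits 𝔸 :=
    B8Prop3GaugeFixedKLevel.mem_unitaryUnits_of_mgauge_eq P.1.2 P.2.2 hu hW
  have hWA : ∀ j, j ≤ (ι a).k → ∀ y τ, SideTouches ((ι a).Ω j) y τ →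
      mgauge P.1.1 u.1⁻¹ P.2.1 y τ = cfgExp (ι a).η (logCfg (ι a).η (mgauge P.1.1 u.1⁻¹ P.2.1)) y τ ∧
        ‖logCfg (ι a).η (mgauge P.1.1 u.1⁻¹ P.2.1) y τ‖ ≤ (5 * (d : ℝ) * L * B₈ * (α₀ + α'')) * ((L : ℝ) ^ j * (ι a).η)⁻¹ :=
    fun j hj y τ h => ⟨(h162 j hj (y, τ) h).1, (h162 j hj (y, τ) h).2.2⟩
  obtain ⟨hA'sa, hA'eq, hA'zero⟩ := B8LeafModelZd3.mlogCfg_spec (ι a).hη hL1 (ι a).k P.1.1 hWu hcs0 hc16 (ι a).Ω hWA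
  set A' := B8LeafModelZd3.mlogCfg (ι a).k (ι a).η (ι a).Ω (mgauge P.1.1 u.1⁻¹ P.2.1) with hA'_def
  have hA'bd : ∀ j, j ≤ (ι a).k → ∀ y τ, SideTouches ((ι a).Ω j) y τ →
      mgauge P.1.1 u.1⁻¹ P.2.1 y τ = cfgExp (ι a).η A' y τ ∧
        ‖A' y τ‖ ≤ (2 * (L * (5 * (d : ℝ) * L * B₈ * (α₀ + α''))) + 8 * (8 * B₀' * (5 * (d : ℝ) * L * B₈) * (α₀ + α''))) *
          ((L : ℝ) ^ j * (ι a).η)⁻¹ := by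
    intro j hj y τ h
    obtain ⟨hAA, hWexp⟩ := hA'eq j hj y τ h
    refine ⟨hWexp, ?_⟩
    rw [hAA]
    have hη0 : 0 ≤ (ι a).η := (ι a).hη.le
    exact ((hWA j hj y τ h).2).trans (mul_le_mul_of_nonneg_right hcK (by positivity))
  have h137 : (zdGF3H 𝔸 L β len (ι a)).C137 α₁ P.1 ((zdGF3H 𝔸 L β len (ι a)).act P u) :=
    B8Eq142KLevelLocal.H42_of_inAx hd2 (ι a).hη hL (ι a).k P.1.2 hα₀ hα₁ hKS0 w5 w6 w7 w9 w10 hsmall₁ (ι a).Ω (ι a).hΩ (ι a).Λs (ι a).Λb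
      (ι a).hbox (ι a).hclass hInA h34 hAx havg (fun m W => LanF a P.1.1 f m W) (ι a).k (ι a).hk le_rfl u.1
      (mgauge P.1.1 u.1⁻¹ P.2.1) A' hu hW hR hLan hA'sa hA'bd hA'zero
  have hPair : (zdGF3H 𝔸 L β len (ι a)).InAPair α₀ P.1 ((zdGF3H 𝔸 L β len (ι a)).act P u) := by
    show InAk L (ι a).k (ι a).η α₀ (ι a).Ω (mulCfg (mgauge P.1.1 u.1⁻¹ P.2.1) P.1.1)
    have hui : ∀ x, u.1⁻¹ x ∈ U1 𝔸 := fun x => unitaryUnits_le_U1 ((unitaryUnits 𝔸).inv_mem (hu x))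
    rw [B8Prop3GaugeFixedKLevel.mulCfg_eq_gaugeAct_of_mgauge_eq hW]
    exact (B8Ineq132.inAk_gaugeAct_iff L (ι a).k (ι a).η α₀ (ι a).Ω hui _).2 h34
  have h162' : (zdGF3H 𝔸 L β len (ι a)).C162 1 (5 * (d : ℝ) * L * B₈ * (α₀ + α'')) P.1 ((zdGF3H 𝔸 L β len (ι a)).act P u) := by
    intro j hj b hb
    obtain ⟨h1, h2, h3⟩ := h162 j hj b hb
    exact ⟨h1, h2, by rw [one_mul]; exact h3⟩
  -- constants: `5dLB₈(α₀ + α″) = B₁(α₀ + α₁)`, `5dL·B₀β·(α₀ + α″) = B₂(α₀ + α₁)`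
  have e1 : 5 * (d : ℝ) * (L : ℝ) * B₈ * (α₀ + α'') = 5 * (d : ℝ) * L * B₈ * (1 + 11 * (d : ℝ) ^ 2) * (α₀ + α₁) := by
    rw [hsum, hD_def]; ring
  have e2 : 5 * (d : ℝ) * (L : ℝ) * B₀β * (α₀ + α'') = 5 * (d : ℝ) * L * B₀β * (1 + 11 * (d : ℝ) ^ 2) * (α₀ + α₁) := by
    rw [hsum, hD_def]; ring
  refine ⟨u, hR, ⟨fun j hj b hb => ?_, ?_, hLF, fun hgrad => ?_⟩, ?_⟩
  · -- (1.62)-shape at `B₁(α₀ + α₁)`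
    obtain ⟨h1, h2, h3⟩ := h162 j hj b hb
    exact ⟨h1, h2, by rw [← e1]; exact h3⟩
  · exact h137
  · -- the conditional (1.36) ∧ (1.39) from the SOURCED Proposition 3 at (α₀, α″, c⋆″)
    have hgrad'' : (zdGF3H 𝔸 L β len (ι a)).fGrad P.1 f < γ * (α₀ + α'') := lt_of_lt_of_le hgrad (mul_le_mul_of_nonneg_left hSS hγ.le)
    obtain ⟨h136, h139⟩ := SP3src a α₀ α'' (5 * (d : ℝ) * L * B₈ * (α₀ + α'')) hα₀ hα₀3 hα'' hα''3 hcspos hcs3 h61 P.1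
      ((zdGF3H 𝔸 L β len (ι a)).act P u) f hInR hfS hgrad'' hInA hPair h162' hLF h137''
    obtain ⟨h136a, h136g, h136h⟩ := h136
    obtain ⟨h139j, h139l⟩ := h139
    refine ⟨⟨fun j hj b hb => ?_, by rw [← e1]; exact h136g, by rw [← e2]; exact h136h⟩,
      ⟨by rw [← e1]; exact h139j, by rw [← e1]; exact h139l⟩⟩
    obtain ⟨h1, h2, h3⟩ := h136a j hj b hb
    exact ⟨h1, h2, by rw [← e1]; exact h3⟩
  -- uniqueness: the core's, since (1.36) at `B₁(α₀ + α₁) = 5dLB₈(α₀ + α″)` is the (1.62)-shape there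
  · intro u' hR' h136' _ _ hLanF'
    refine huniq u' hR' ((hLanF a P.1.1 f _).2 hLanF') ?_
    intro j hj b hb
    obtain ⟨h1, h2, h3⟩ := h136'.1 j hj b hb
    refine ⟨h1, h2, ?_⟩
    rw [e1]
    exact h3

end Thm8

#print axioms thm4Core_zd3_map_lanE
#print axioms thm8SurvivingAt_zd3H_map_lanE

end Literature.MathematicalPhysics.QuantumFieldTheory.Balaban1983to89.B8Thm8SurvivingZd3MapHE

end
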